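/-
COR-CM (cell pub-hodgecm2, stage 2 of the Hodge ladder) — Δ2 BRIDGE, ORIENTATION AUDIT, TEST T2 — THE COMPOSITE (wb-9, transport route).
THEOREMS ONLY; nothing landed is edited or restated; no named fact, no `sorry`.  HC_CM is NOT proved; «Δ2 BRIDGE CLOSED» is NOT claimed.
-/
import Summits.HodgeConjecture.CorCM.D2Bridge.OrientationT2BlockVanishing
import Summits.HodgeConjecture.CorCM.D2Bridge.CmClassesHodgeType
import Summits.HodgeConjecture.CorCM.B01.Transposition.Item6BlockNonvanishingOfProp413
import HarnessLib

/-!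
# Δ2 bridge, orientation test T2 — composite: at the literal pin, `Thm418C ∧ Prop413 ∧ (D)` is contradictory at every good `PhiMu` line

Plugging the two tree-derivable inputs of `OrientationT2BlockVanishing.block_pin_eq_bot_of_thm418C_of_hodgeTypes` BY VALUE:
* (T1) `cmClasses K i ⊆ H^{1,0}(P_K)` at `PhiMu` lines — prove-8's `cmClasses_subset_hodge_piece_one_zero_pin` (`CmClassesHodgeType`);
* `block i ≠ ⊥` — item6-p3's `block_ne_bot_of_prop413` (`Item6BlockNonvanishingOfProp413`) from `Prop413` AS TYPED and ONE non-zero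
  oscillator module `(line i).Ω (ιVE V) χ` (at the pin: [Liu21, Lem. D.1 (1)] via the Ω-pin, `hnvD`).
What remains displayed: `h418 : 𝔇.Thm418C` (the plug's output) and `h413 : 𝔇.Prop413`; what remains NEITHER displayed NOR a tree theorem:
`hD` — the `(0,1)`-type of the block's restrictions ([Liu21, (4.2) ∕ Prop. 4.13] read at the PATH-A pin `τ' = ῑ₁`).
-/

set_option autoImplicit false

noncomputable section

namespace Summit.HodgeConjecture.CorCM.D2Bridge

open HodgeCM HodgeCM.Model
open HodgeCM.Literature.Theta HodgeCM.Literature.Theta.LiuAlbaneseModuleDatum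
open Literature.AlgebraicGeometry.HodgeTheory
open Literature.NumberTheory.Automorphic.PicardCM
open Literature.NumberTheory.Transcendental (Arapura2012_Cor_15_4_6)
open Summit.HodgeConjecture.CorCM.Transposition.BlockNonvanishing (block_ne_bot_of_prop413)

variable {L : CMField} {ι₁ : L →+* ℂ} (V : HermSpace3 L ι₁) (I : Type) (line : I → SplitLineE V)

/-- **T2 COMPOSITE AT THE LITERAL PIN: `block i = ⊥` from `Thm418C` + (D)**, (T1) discharged by prove-8's `CmClassesHodgeType`.
[cite: VoisinHodgeI2002, §6.1.3 Cor. 6.14] [cite: Shimura1998, §8.3 Prop. 28] -/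
theorem block_pin_eq_bot_of_thm418C_of_hD [IsGalois ℚ (L : Type)]
    (hHD : exists_isReal_hodgeModel) (hI : hodgePQ_independent_of_hodgeModel)
    (h₁ : BallQuotientUniformised) (h₃ : CMAbelianVarietyRealised) (hA : Arapura2012_Cor_15_4_6) (i : I)
    (h418 : (liuDictionaryPin hHD hI h₁ h₃ hA V I line).Thm418C) (hΦ : SplitLine.PhiMuLine ι₁ (line i))
    (hD : ∃ Γ₁ : Level V, ∀ Γ ≤ Γ₁, ∀ x ∈ (liuDictionaryPin hHD hI h₁ h₃ hA V I line).block i,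
      x ∈ fixedBy Γ.K (liuDictionaryPin hHD hI h₁ h₃ hA V I line).H →
        (liuDictionaryPin hHD hI h₁ h₃ hA V I line).res Γ x ∈
          ((picardCMUniverse hHD hI h₁ h₃).hodge ((picardCMUniverse hHD hI h₁ h₃).pms L ι₁ V Γ) 1).piece 0 1) :
    (liuDictionaryPin hHD hI h₁ h₃ hA V I line).block i = ⊥ :=
  block_pin_eq_bot_of_thm418C_of_hodgeTypes V I line hHD hI h₁ h₃ hA i h418 hΦ
    (fun K => cmClasses_subset_hodge_piece_one_zero_pin V I line K i hΦ) hD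

/-- **T2 COMPOSITE, inconsistency form: `Thm418C ∧ Prop413 ∧ (ω ≠ 0) ∧ (D) ⟹ False` at every `PhiMu` line carrying a non-zero
automorphic oscillator module** — every input displayed or tree-derived except `hD`. [cite: VoisinHodgeI2002, §6.1.3 Cor. 6.14] -/
theorem false_of_thm418C_pin_of_prop413_of_hD [IsGalois ℚ (L : Type)]
    (hHD : exists_isReal_hodgeModel) (hI : hodgePQ_independent_of_hodgeModel)
    (h₁ : BallQuotientUniformised) (h₃ : CMAbelianVarietyRealised) (hA : Arapura2012_Cor_15_4_6) (i : I)
    (h418 : (liuDictionaryPin hHD hI h₁ h₃ hA V I line).Thm418C) (h413 : (liuDictionaryPin hHD hI h₁ h₃ hA V I line).Prop413)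
    (hΦ : SplitLine.PhiMuLine ι₁ (line i))
    (a : (liuDictionaryPin hHD hI h₁ h₃ hA V I line).Adm i) [Nontrivial ((liuDictionaryPin hHD hI h₁ h₃ hA V I line).Ω i a)]
    (hD : ∃ Γ₁ : Level V, ∀ Γ ≤ Γ₁, ∀ x ∈ (liuDictionaryPin hHD hI h₁ h₃ hA V I line).block i,
      x ∈ fixedBy Γ.K (liuDictionaryPin hHD hI h₁ h₃ hA V I line).H →
        (liuDictionaryPin hHD hI h₁ h₃ hA V I line).res Γ x ∈
          ((picardCMUniverse hHD hI h₁ h₃).hodge ((picardCMUniverse hHD hI h₁ h₃).pms L ι₁ V Γ) 1).piece 0 1) : False :=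
  block_ne_bot_of_prop413 _ h413 i a (block_pin_eq_bot_of_thm418C_of_hD V I line hHD hI h₁ h₃ hA i h418 hΦ hD)

end Summit.HodgeConjecture.CorCM.D2Bridge

end
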